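import Mathlib.Combinatorics.Hall.Basic
import Summits.ValiantsHypothesis.ValiantsHypothesis.Theorems.KPlusLogSqLawTropicalPageRigidityK

/-!
# Route «KPlusLogSqLaw», cruxes `WeakLifting` / `TropicalB` — LEX TOP-CLASS RIGIDITY, perfect-matching form (`k` terms; König)

HONEST FRAMING.  Helper file (cell `pub-symmetroid`, seat val-sym-lift-p3 g4, 2026-08-27) toward the crux
`Summit.ValiantsHypothesis.ValiantsHypothesis.Theses.KPlusLogSqLaw.WeakLifting` (ledger item `stmt-ValiantsHypothesis-19561`; docket D2, the
`K = 4` tropical exponent fork).  It upgrades the `k`-term re-decomposition law of `…TropicalPageRigidityK` (`classCount_eq_of_redecomp`)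
to single competitor terms, as `…TropicalPageRigidityMatching` did for `k = 3`.  A STRUCTURAL law for dominant terms of an arbitrary design
in the lex regime of one class; it proves no stub and asserts nothing about `TropicalB`, `WeakLifting`, `Lifting`, `KPlusLogSqLaw`,
`MatrixDescartes` (stmt-ValiantsHypothesis-18050) or `VP ≠ VNP`.

THE LAW (`classCount_eq_of_recombination`).  If `d l⋆ ≥ (k/2)·m·D` with `D ≥` every other exponent, and `t₀, …, t_{k−1}` are unique optima at
strictly increasing slopes (`k ≥ 1`) with the same `l⋆`-count `c`, then EVERY term obtained by choosing in each column one of the `k`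
entries of the `t`'s (rows bijective) has `l⋆`-count `c`.  With `k` up to `m` this is PAGE RIGIDITY proper: every perfect matching supported on the union of
`≤ m` same-page terms — e.g. on the union support of a whole page of a strongly lex design — carries the page's top count.

PROOF.  KÖNIG'S LEMMA in the needed form (`pageRigid_konig`): `k` layers of (row, class) data over the columns in which every row occurs
exactly `k` times can be re-assembled into `k` terms (permutations with classes) with the same columnwise multisets — induction on `k`,
Hall's marriage theorem (Mathlib `Finset.all_card_le_biUnion_card_iff_exists_injective`) extracting one term at a time
(`pageRigid_leftover_regular`: removing a transversal leaves a `(k−1)`-regular family).  The chosen term plus a König re-assembly of its leftover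
is a columnwise re-decomposition of the `t`'s, and `classCount_eq_of_redecomp` applies.
[folklore: König's 1-factorisation of regular bipartite multigraphs; the packaging is the cell's]
-/

set_option linter.dupNamespace false
set_option autoImplicit false

namespace Summit.ValiantsHypothesis.ValiantsHypothesis.Theorems.LacunarySymmetroidMatrixDescartes.TropicalCensus

open Summit.ValiantsHypothesis.ValiantsHypothesis.Theorems.MatrixDescartes.Negative
open scoped BigOperators
open Finset

section PageRigidityMatchingK

variable {m K : ℕ}

/-- Removing a transversal (one slot per column, rows bijective) from a family of `k+1` layers in which every row occurs `k+1` times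
leaves a family of `k` layers in which every row occurs `k` times. [folklore] -/
theorem pageRigid_leftover_regular {k : ℕ} (e : Fin (k + 1) → Fin m → Fin m × Fin K)
    (hreg : ∀ a : Fin m, ((univ : Finset (Fin (k + 1) × Fin m)).filter fun p => (e p.1 p.2).1 = a).card = k + 1)
    (c : Fin m → Fin (k + 1)) (hbij : Function.Bijective fun i => (e (c i) i).1) (a : Fin m) :
    ((univ : Finset (Fin k × Fin m)).filter fun p => (e ((c p.2).succAbove p.1) p.2).1 = a).card = k := by
  classical
  -- embed the leftover slots into the slots of `e` off the transversal
  let φ : Fin k × Fin m → Fin (k + 1) × Fin m := fun p => ((c p.2).succAbove p.1, p.2)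
  have hφ : Function.Injective φ := by
    intro p q hpq
    simp only [φ, Prod.mk.injEq] at hpq
    obtain ⟨h1, h2⟩ := hpq
    have hq : p.2 = q.2 := h2
    rw [hq] at h1
    exact Prod.ext (Fin.succAbove_right_injective h1) hq
  have himg : ((univ : Finset (Fin k × Fin m)).filter fun p => (e ((c p.2).succAbove p.1) p.2).1 = a).image φ
      = (((univ : Finset (Fin (k + 1) × Fin m)).filter fun p => (e p.1 p.2).1 = a).erase (c (Function.surjInv hbij.2 a),
          Function.surjInv hbij.2 a)) := by
    ext q
    simp only [mem_image, mem_filter, mem_univ, true_and, mem_erase, φ]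
    constructor
    · rintro ⟨p, hp, rfl⟩
      refine ⟨?_, hp⟩
      intro h
      have hs := (Prod.mk.inj h).2
      have h2 := (Prod.mk.inj h).1
      rw [hs] at h2
      exact Fin.succAbove_ne _ _ h2
    · rintro ⟨hne, hq⟩
      -- q = (j, i) with j ≠ c i (else it is the transversal slot of row a)
      have hj : q.1 ≠ c q.2 := by
        intro hj
        apply hne
        have hrow : (e (c q.2) q.2).1 = a := by rw [← hj]; exact hq
        have hi : q.2 = Function.surjInv hbij.2 a := by
          have h1 : (fun i => (e (c i) i).1) q.2 = (fun i => (e (c i) i).1) (Function.surjInv hbij.2 a) := by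
            show (e (c q.2) q.2).1 = (e (c (Function.surjInv hbij.2 a)) (Function.surjInv hbij.2 a)).1
            rw [hrow]; exact (Function.surjInv_eq hbij.2 a).symm
          exact hbij.1 h1
        rw [← hi, ← hj]
      obtain ⟨j, hj'⟩ := Fin.exists_succAbove_eq hj
      exact ⟨(j, q.2), by show (e ((c q.2).succAbove j) q.2).1 = a; rw [hj']; exact hq,
        by show ((c q.2).succAbove j, q.2) = q; rw [hj']⟩
  have hmem : (c (Function.surjInv hbij.2 a), Function.surjInv hbij.2 a) ∈
      ((univ : Finset (Fin (k + 1) × Fin m)).filter fun p => (e p.1 p.2).1 = a) := by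
    rw [mem_filter]
    exact ⟨mem_univ _, Function.surjInv_eq hbij.2 a⟩
  have := card_image_of_injective
    ((univ : Finset (Fin k × Fin m)).filter fun p => (e ((c p.2).succAbove p.1) p.2).1 = a) hφ
  rw [himg, card_erase_of_mem hmem, hreg] at this
  omega

/-- **König's lemma (the form needed here).**  `k` layers of (row, class) data over `Fin m` columns in which every row occurs exactly
`k` times can be re-assembled into `k` terms (permutation, class vector) with the same columnwise multisets. [folklore] -/
theorem pageRigid_konig : ∀ (k : ℕ) (e : Fin k → Fin m → Fin m × Fin K),
    (∀ a : Fin m, ((univ : Finset (Fin k × Fin m)).filter fun p => (e p.1 p.2).1 = a).card = k) →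
    ∃ u : Fin k → Equiv.Perm (Fin m) × (Fin m → Fin K),
      ∀ i, (univ : Finset (Fin k)).val.map (fun j => ((u j).1 i, (u j).2 i)) = (univ : Finset (Fin k)).val.map (fun j => e j i) := by
  classical
  intro k
  induction k with
  | zero =>
    intro e _
    exact ⟨fun j => Fin.elim0 j, fun i => by simp⟩
  | succ k ih =>
    intro e hreg
    -- Hall: a transversal with distinct rows
    let L : Fin m → Finset (Fin m) := fun i => (univ : Finset (Fin (k + 1))).image fun j => (e j i).1
    have hHall : ∀ s : Finset (Fin m), s.card ≤ (s.biUnion L).card := by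
      intro s
      let P : Finset (Fin (k + 1) × Fin m) := (univ : Finset (Fin (k + 1))) ×ˢ s
      let g : Fin (k + 1) × Fin m → Fin m := fun p => (e p.1 p.2).1
      have hPcard : P.card = (k + 1) * s.card := by
        simp only [P, card_product, card_univ, Fintype.card_fin]
      have himg : P.image g ⊆ s.biUnion L := by
        intro a ha
        rw [mem_image] at ha
        obtain ⟨p, hp, rfl⟩ := ha
        simp only [P, mem_product, mem_univ, true_and] at hp
        rw [mem_biUnion]
        exact ⟨p.2, hp, mem_image.mpr ⟨p.1, mem_univ _, rfl⟩⟩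
      have hfib : ∀ a ∈ P.image g, (P.filter fun p => g p = a).card ≤ k + 1 := by
        intro a _
        calc (P.filter fun p => g p = a).card
            ≤ ((univ : Finset (Fin (k + 1) × Fin m)).filter fun p => (e p.1 p.2).1 = a).card :=
              card_le_card fun p hp => by
                rw [mem_filter] at hp ⊢; exact ⟨mem_univ _, hp.2⟩
          _ = k + 1 := hreg a
      have hle := card_le_mul_card_image P (k + 1) hfib
      have h2 := card_le_card himg
      rw [hPcard] at hle
      have : s.card ≤ (P.image g).card := by
        by_contra h; push Not at h
        have : (k + 1) * (P.image g).card < (k + 1) * s.card := Nat.mul_lt_mul_of_pos_left h (Nat.succ_pos k)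
        omega
      omega
    obtain ⟨f, hfinj, hfmem⟩ := (all_card_le_biUnion_card_iff_exists_injective L).mp hHall
    have hc : ∀ i, ∃ j, (e j i).1 = f i := by
      intro i
      have := hfmem i
      simp only [L, mem_image, mem_univ, true_and] at this
      exact this
    choose c hc using hc
    have hbij : Function.Bijective fun i => (e (c i) i).1 := by
      have : (fun i => (e (c i) i).1) = f := funext hc
      rw [this]; exact Finite.injective_iff_bijective.mp hfinj
    -- the leftover is k-regular; re-assemble it by induction
    let e' : Fin k → Fin m → Fin m × Fin K := fun j i => e ((c i).succAbove j) i
    have hreg' := pageRigid_leftover_regular e hreg c hbij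
    obtain ⟨u', hu'⟩ := ih e' hreg'
    -- the extracted term
    let M : Equiv.Perm (Fin m) × (Fin m → Fin K) := (Equiv.ofBijective _ hbij, fun i => (e (c i) i).2)
    refine ⟨Fin.cons M u', fun i => ?_⟩
    -- left side: cons
    have hL : (univ : Finset (Fin (k + 1))).val.map (fun j => (((Fin.cons M u' : Fin (k + 1) → _) j).1 i,
        ((Fin.cons M u' : Fin (k + 1) → _) j).2 i))
        = e (c i) i ::ₘ (univ : Finset (Fin k)).val.map (fun j => e' j i) := by
      rw [Fin.univ_succ, cons_val, Multiset.map_cons, map_val, Multiset.map_map]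
      congr 1
      rw [← hu' i]
      rfl
    -- right side: split at the pivot c i
    have hR : (univ : Finset (Fin (k + 1))).val.map (fun j => e j i)
        = e (c i) i ::ₘ (univ : Finset (Fin k)).val.map (fun j => e' j i) := by
      rw [Fin.univ_succAbove k (c i), cons_val, Multiset.map_cons, map_val, Multiset.map_map]
      rfl
    rw [hL, hR]

/-- **LEX TOP-CLASS RIGIDITY, perfect-matching form (`k` terms).**  If the exponent of the class `l⋆` is at least `(k/2)·m` times every
other exponent and `t₀, …, t_{k−1}` are dominant at strictly increasing slopes with the same `l⋆`-count `c`, then every term obtained by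
choosing in each column one of the `k` entries (rows bijective) has `l⋆`-count `c`. [folklore] -/
theorem classCount_eq_of_recombination {k : ℕ} (d : Fin K → ℕ) (v ε : Fin m → Fin m → Fin K → ℤ)
    (θ : Fin k → ℤ) (hθ : StrictMono θ) (t : Fin k → Equiv.Perm (Fin m) × (Fin m → Fin K))
    (hdom : ∀ r, IsDominant d v ε (θ r) (t r))
    (lstar : Fin K) (D : ℕ) (hD : ∀ l, l ≠ lstar → d l ≤ D) (hlex : (k / 2) * m * D ≤ d lstar)
    (c : ℕ) (hc : ∀ r, (univ.filter fun i => (t r).2 i = lstar).card = c) (hk : 0 < k)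
    (sel : Fin m → Fin k) (hbij : Function.Bijective fun i => (t (sel i)).1 i) :
    (univ.filter fun i => (t (sel i)).2 i = lstar).card = c := by
  classical
  obtain ⟨n, rfl⟩ : ∃ n, k = n + 1 := ⟨k - 1, by omega⟩
  -- the layers and their regularity
  let e : Fin (n + 1) → Fin m → Fin m × Fin K := fun j i => ((t j).1 i, (t j).2 i)
  have hreg : ∀ a : Fin m, ((univ : Finset (Fin (n + 1) × Fin m)).filter fun p => (e p.1 p.2).1 = a).card = n + 1 := by
    intro a
    have h : ((univ : Finset (Fin (n + 1) × Fin m)).filter fun p => (e p.1 p.2).1 = a)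
        = (univ : Finset (Fin (n + 1))).image (fun j => (j, ((t j).1).symm a)) := by
      ext p
      simp only [mem_filter, mem_univ, true_and, mem_image, e]
      constructor
      · intro hp
        refine ⟨p.1, ?_⟩
        have : ((t p.1).1).symm a = p.2 := by rw [← hp]; simp
        rw [this]
      · rintro ⟨j, rfl⟩
        simp
    rw [h, card_image_of_injective _ (fun j j' hjj' => (Prod.mk.inj hjj').1)]
    simp
  have hbij' : Function.Bijective fun i => (e (sel i) i).1 := hbij
  -- leftover and its König re-assembly
  let e' : Fin n → Fin m → Fin m × Fin K := fun j i => e ((sel i).succAbove j) i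
  have hreg' := pageRigid_leftover_regular e hreg sel hbij'
  obtain ⟨u', hu'⟩ := pageRigid_konig n e' hreg'
  let M : Equiv.Perm (Fin m) × (Fin m → Fin K) := (Equiv.ofBijective _ hbij, fun i => (t (sel i)).2 i)
  let U : Fin (n + 1) → Equiv.Perm (Fin m) × (Fin m → Fin K) := Fin.cons M u'
  have hcol : ∀ i : Fin m, (univ : Finset (Fin (n + 1))).val.map (fun r => ((U r).1 i, (U r).2 i)) =
      (univ : Finset (Fin (n + 1))).val.map (fun r => ((t r).1 i, (t r).2 i)) := by
    intro i
    have hL : (univ : Finset (Fin (n + 1))).val.map (fun r => ((U r).1 i, (U r).2 i))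
        = e (sel i) i ::ₘ (univ : Finset (Fin n)).val.map (fun j => e' j i) := by
      rw [Fin.univ_succ, cons_val, Multiset.map_cons, map_val, Multiset.map_map]
      congr 1
      rw [← hu' i]
      rfl
    have hR : (univ : Finset (Fin (n + 1))).val.map (fun r => ((t r).1 i, (t r).2 i))
        = e (sel i) i ::ₘ (univ : Finset (Fin n)).val.map (fun j => e' j i) := by
      rw [Fin.univ_succAbove n (sel i), cons_val, Multiset.map_cons, map_val, Multiset.map_map]
      rfl
    rw [hL, hR]
  have hall := classCount_eq_of_redecomp d v ε θ hθ t U hdom hcol lstar D hD hlex c hc 0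
  simpa [U] using hall

end PageRigidityMatchingK

end Summit.ValiantsHypothesis.ValiantsHypothesis.Theorems.LacunarySymmetroidMatrixDescartes.TropicalCensus
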